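import Literature.Geometry.Lorentzian.KerrData
import Literature.Geometry.Lorentzian.InitialDataPullback
import Literature.Geometry.Lorentzian.AFEndBreathingData
import HarnessLib

/-!
# Initial data sets with an exact Kerr end

(family `gr`; namespace `Literature.Geometry.Lorentzian.InitialDataSet`; definition request
`defn-HasExactKerrEnd` of route `ExactKerrEnds` of the final-state summit.)

An initial data set `D = (h, k)` on a `3`-manifold `X` **has an exact Kerr end** (is *Kerr-ended*)
if OUTSIDE A COMPACT SET it is an exact spacelike leaf of a Kerr chart: there are a compact
`K ⊆ X`, an open `U ⊆ ℝ³`, Kerr parameters `0 ≤ M`, `a` and a chart floor `r₀`, a smooth open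
embedding `φ : U → X` covering `X ∖ K`, an injective spacelike immersion `ψ : U → Kerr.region a r₀`
into the ingoing Kerr–Schild chart `({r > max r₀ 0}, g_{M,a})` (`Kerr.smoothMetric`) with future
unit normal `ν` (time orientation `−g♯dt*`, `Kerr.timeOrientation`), such that off `K`
`φ^* h = ψ^* g_{M,a}` and `φ^* k = K_ν(ψ)` (second fundamental form w.r.t. the FUTURE unit normal,
sign `K_ν(v, w) = + g(D_v ν, dψ w)`, the convention of `InitialDataSet`). This is the class of
data produced by the Corvino–Schoen gluing: "data which is exactly that of a spacelike slice of a
suitably chosen Kerr metric outside a compact set" (Corvino–Schoen 2006, §1, p. 1; Thm. 4, p. 23: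
the glued solution "agrees with a suitably chosen member of the admissible family on `E_{2R}`",
the Kerr slices forming an admissible family).

## Contents

* `InitialDataSet.IsExactKerrEndAlong D K U M a r₀ hM φ ψ ν` — the END DATA predicate (the nine
  clauses above for a given tuple; verbatim the clauses of the let-bound legend `KerrEnded` of
  route `ExactKerrEnds`, items `TameEscapeToKerrEnds`, `CensorshipAlongKerrEnds`,
  `SettlingAlongCensoredKerrEnds`, `ExactKerrFarDevelopment`), with accessors (all but
  `Injective ψ` = `h.2.2.2.2.1`, whose one-line accessor the statement-dedup lint rejects).
* `InitialDataSet.HasExactKerrEnd D := ∀ [Kerr.Facts], ∃ K U M a r₀ hM φ ψ ν, …` — the notion;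
  `hasExactKerrEnd_iff` unfolds it to the legend VERBATIM (`Iff.rfl`): the items restate 1:1.
* Bookkeeping (all proved): `IsExactKerrEndAlong.mono` (enlarge `K`);
  `IsExactKerrEndAlong.of_eq_off_compact`, `HasExactKerrEnd.of_eq_off_compact` — **stability
  under modification on a compact set** (`D' = D` off a compact `B`, `h` and `k` pointwise ⇒
  exceptional set `K ∪ B`, same chart); `IsExactKerrEndAlong.comap_of_inverse`,
  `HasExactKerrEnd.comap_of_inverse`, `HasExactKerrEnd.comap_diffeomorph` — **invariance under
  pull-back by a diffeomorphism** `Θ : X' → X` with smooth inverse `Ψ` (end data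
  `(Ψ '' K, U, M, a, r₀, Ψ ∘ φ, ψ, ν)` for `Θ^* D = D.comap Θ`; chain rule `(Θ ∘ Ψ ∘ φ)^* = φ^*`);
  `HasExactKerrEnd.breatheFamily` — the breathing family (`AFEndBreathingData.lean`) of a
  Kerr-ended datum consists of Kerr-ended data (its members agree with `D` off the compact core).
* Non-vacuity: `Kerr.isExactKerrEndAlong_data`, `Kerr.hasExactKerrEnd_data` — the Kerr–Schild
  slice data `Kerr.data M a r₀ hM` are Kerr-ended (`K = ∅`, `φ = id`, `ψ = sliceEmbed`,
  `ν = sliceNormal`, given the named fact `Kerr.isFutureUnitNormal_sliceNormal`).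

## Design choices

* The Kerr facts guard `∀ [Kerr.Facts]` is INSIDE `HasExactKerrEnd` (as in the legend), so that
  the notion is a plain predicate on `InitialDataSet (𝓡 3) X` usable in statements that do not bind
  `[Kerr.Facts]`; `IsExactKerrEndAlong` mentions the Kerr metric and therefore binds `[Kerr.Facts]`.
* The leaf `ψ` is ANY injective spacelike immersion into the Kerr–Schild chart region (not the
  slice `{t* = 0}`): Kerr–Schild slices are not Dafermos–Rodnianski admissible
  (`Kerr.not_isStronglyAsymptoticallyFlatDR_data`), bent Boyer–Lindquist-type leaves are; the
  notion does not choose.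
* The clause on `k` binds `∀ [(Kerr.smoothMetric M a r₀).HasLeviCivita]` (the standing hypothesis
  of `secondFundamentalForm`), exactly as `KerrLeafExactPartChart` (`KerrExactRegionFacts.lean`).
* Pull-backs of data are `InitialDataSet.comap` (`InitialDataPullback.lean`), whose smoothness
  exponent is written `∞ + 1`; the diffeomorphism lemmas take the `comap` hypotheses `hΘ`, `hΘ'`
  explicitly (house pattern of `AFEndTransport.lean`).
* Proving a goal `D.HasExactKerrEnd` under an ambient `[Kerr.Facts]`: use tactic form
  (`intro _; exact ⟨K, U, M, a, r₀, hM, φ, ψ, ν, h⟩`, or `IsExactKerrEndAlong.hasExactKerrEnd`) — a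
  term-mode implicit lambda trips `linter.overlappingInstances` on the two `[Kerr.Facts]`; the two
  instances are definitionally equal (`Kerr.Facts` is a `Prop`), so nothing else is affected.

Not here: that Kerr-ended admissible data exist on a given `X` (Corvino–Schoen 2006, Thm. 4/5 —
route item `TameEscapeToKerrEnds`), and anything about developments of Kerr-ended data.

## References

* J. Corvino, R. Schoen, *On the asymptotics for the vacuum Einstein constraint equations*,
  J. Differential Geom. 73 (2006) 185–217, §1 and Thm. 4. [CorvinoSchoen2006]
* R. Bartnik, J. Isenberg, *The constraint equations* (2004), §2. [BartnikIsenberg2004]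
* B. O'Neill, *Semi-Riemannian geometry* (1983), Ch. 3, p. 58. [ONeill1983]
* M. Dafermos, I. Rodnianski, *Lectures on black holes and linear waves*, arXiv:0811.0354, §5.1
  (the ingoing Kerr–Schild chart). [arXiv08110354]
-/

noncomputable section

open Bundle Set Function TopologicalSpace Manifold _root_.Topology
open scoped ContDiff

namespace Literature.Geometry.Lorentzian

namespace InitialDataSet

variable {X : Type*} [TopologicalSpace X] [ChartedSpace E3 X] [IsManifold (𝓡 3) ∞ X]

/-! ### The end data predicate and the notion -/

/-- **Exact Kerr end data** for the initial data set `D` on the `3`-manifold `X`: the tuple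
`(K, U, M, a, r₀, φ, ψ, ν)` — a compact `K ⊆ X`, an open `U ⊆ ℝ³`, Kerr parameters `M ≥ 0`, `a` and
a chart floor `r₀`, a map `φ : U → X`, a leaf `ψ : U → Kerr.region a r₀` in the ingoing
Kerr–Schild chart and a field `ν` along `ψ` — EXHIBITS `D` AS AN EXACT SPACELIKE KERR LEAF OFF `K`:
`K` is compact,
`X ∖ K ⊆ range φ`, `φ` is a smooth open embedding, `ψ` is an injective spacelike immersion for
`g_{M,a}` with future unit normal `ν` (time orientation `−g♯dt*`), and at every `y` with `φ y ∉ K`,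
`h(dφ v, dφ w) = g_{M,a}(dψ v, dψ w)` and `k(dφ v, dφ w) = K_ν(ψ)(v, w)` (future normal, sign
`K_ν(v, w) = + g(D_v ν, dψ w)`). Verbatim the clauses of the legend `KerrEnded` of route
`ExactKerrEnds` (final-state summit). Corvino–Schoen 2006, §1 ("data which is exactly that of a
spacelike slice of a suitably chosen Kerr metric outside a compact set") and Thm. 4.
[cite: CorvinoSchoen2006, §1 and Thm. 4] -/
def IsExactKerrEndAlong [Kerr.Facts] (D : InitialDataSet (𝓡 3) X) (K : Set X) (U : Opens E3)
    (M a r₀ : ℝ) (hM : 0 ≤ M) (φ : U → X) (ψ : U → Kerr.region a r₀)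
    (ν : NormalField 𝓘(ℝ, E4) ψ) : Prop :=
  IsCompact K ∧ Kᶜ ⊆ range φ ∧ IsOpenEmbedding φ ∧
    ContMDiff 𝓘(ℝ, E3) (𝓡 3) ∞ φ ∧ Injective ψ ∧
    (Kerr.smoothMetric M a r₀).IsSpacelikeImmersion 𝓘(ℝ, E3) ψ ∧
    (Kerr.smoothMetric M a r₀).IsFutureUnitNormal 𝓘(ℝ, E3)
      ((Kerr.timeOrientation M a r₀ hM).ofLE le_top) ψ ν ∧
    (∀ (y : U) (v w : E3), φ y ∉ K →
      D.h.inner (φ y) (mfderiv 𝓘(ℝ, E3) (𝓡 3) φ y v) (mfderiv 𝓘(ℝ, E3) (𝓡 3) φ y w) =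
        Kerr.bilin M a (ψ y : E4) (mfderiv 𝓘(ℝ, E3) 𝓘(ℝ, E4) ψ y v)
          (mfderiv 𝓘(ℝ, E3) 𝓘(ℝ, E4) ψ y w)) ∧
    (∀ [(Kerr.smoothMetric M a r₀).HasLeviCivita] (y : U) (v w : E3), φ y ∉ K →
      D.k (φ y) (mfderiv 𝓘(ℝ, E3) (𝓡 3) φ y v) (mfderiv 𝓘(ℝ, E3) (𝓡 3) φ y w) =
        (Kerr.smoothMetric M a r₀).secondFundamentalForm 𝓘(ℝ, E3) ψ ν y v w)

/-- **The initial data set `D` has an exact Kerr end** (is *Kerr-ended*): granted the Kerr–Schild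
facts `[Kerr.Facts]`, there are exact Kerr end data `(K, U, M, a, r₀, φ, ψ, ν)` for `D`
(`IsExactKerrEndAlong`) — outside the compact `K`, `D` is an exact spacelike leaf, with its induced
metric and future second fundamental form, of the Kerr metric `g_{M,a}`, `M ≥ 0`, in the ingoing
Kerr–Schild chart. The let-bound legend `KerrEnded` of route `ExactKerrEnds` (final-state
summit), see `hasExactKerrEnd_iff`. Corvino–Schoen 2006, §1 and Thm. 4 (vacuum data identical to
a Kerr slice outside a compact set). [cite: CorvinoSchoen2006, §1 and Thm. 4] -/
def HasExactKerrEnd (D : InitialDataSet (𝓡 3) X) : Prop :=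
  ∀ [Kerr.Facts], ∃ (K : Set X) (U : Opens E3) (M a r₀ : ℝ) (hM : 0 ≤ M) (φ : U → X)
    (ψ : U → Kerr.region a r₀) (ν : NormalField 𝓘(ℝ, E4) ψ),
    D.IsExactKerrEndAlong K U M a r₀ hM φ ψ ν

/-- `HasExactKerrEnd` unfolded VERBATIM to the let-bound legend `KerrEnded` of route
`ExactKerrEnds` of the final-state summit (definitional).
[cite: CorvinoSchoen2006, §1 and Thm. 4] -/
theorem hasExactKerrEnd_iff (D : InitialDataSet (𝓡 3) X) :
    D.HasExactKerrEnd ↔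
      ∀ [Kerr.Facts], ∃ (K : Set X) (U : Opens E3) (M a r₀ : ℝ) (hM : 0 ≤ M) (φ : U → X)
        (ψ : U → Kerr.region a r₀) (ν : NormalField 𝓘(ℝ, E4) ψ),
        IsCompact K ∧ Kᶜ ⊆ range φ ∧ IsOpenEmbedding φ ∧
        ContMDiff 𝓘(ℝ, E3) (𝓡 3) ((⊤ : ℕ∞) : WithTop ℕ∞) φ ∧ Injective ψ ∧
        (Kerr.smoothMetric M a r₀).IsSpacelikeImmersion 𝓘(ℝ, E3) ψ ∧
        (Kerr.smoothMetric M a r₀).IsFutureUnitNormal 𝓘(ℝ, E3)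
          ((Kerr.timeOrientation M a r₀ hM).ofLE le_top) ψ ν ∧
        (∀ (y : U) (v w : E3), φ y ∉ K →
          D.h.inner (φ y) (mfderiv 𝓘(ℝ, E3) (𝓡 3) φ y v) (mfderiv 𝓘(ℝ, E3) (𝓡 3) φ y w) =
            Kerr.bilin M a (ψ y : E4) (mfderiv 𝓘(ℝ, E3) 𝓘(ℝ, E4) ψ y v)
              (mfderiv 𝓘(ℝ, E3) 𝓘(ℝ, E4) ψ y w)) ∧
        (∀ [(Kerr.smoothMetric M a r₀).HasLeviCivita] (y : U) (v w : E3), φ y ∉ K →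
          D.k (φ y) (mfderiv 𝓘(ℝ, E3) (𝓡 3) φ y v) (mfderiv 𝓘(ℝ, E3) (𝓡 3) φ y w) =
            (Kerr.smoothMetric M a r₀).secondFundamentalForm 𝓘(ℝ, E3) ψ ν y v w) :=
  Iff.rfl

/-- A datum with exact Kerr end data has an exact Kerr end. [folklore] -/
theorem IsExactKerrEndAlong.hasExactKerrEnd [Kerr.Facts] {D : InitialDataSet (𝓡 3) X} {K : Set X}
    {U : Opens E3} {M a r₀ : ℝ} {hM : 0 ≤ M} {φ : U → X} {ψ : U → Kerr.region a r₀}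
    {ν : NormalField 𝓘(ℝ, E4) ψ} (h : D.IsExactKerrEndAlong K U M a r₀ hM φ ψ ν) :
    D.HasExactKerrEnd := by
  intro _
  exact ⟨K, U, M, a, r₀, hM, φ, ψ, ν, h⟩

/-- Granted `[Kerr.Facts]`, a Kerr-ended datum has exact Kerr end data. [folklore] -/
theorem HasExactKerrEnd.exists [Kerr.Facts] {D : InitialDataSet (𝓡 3) X} (h : D.HasExactKerrEnd) :
    ∃ (K : Set X) (U : Opens E3) (M a r₀ : ℝ) (hM : 0 ≤ M) (φ : U → X)
      (ψ : U → Kerr.region a r₀) (ν : NormalField 𝓘(ℝ, E4) ψ),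
      D.IsExactKerrEndAlong K U M a r₀ hM φ ψ ν :=
  h

/-! ### Accessors -/

namespace IsExactKerrEndAlong

variable [Kerr.Facts] {D : InitialDataSet (𝓡 3) X} {K : Set X} {U : Opens E3} {M a r₀ : ℝ}
  {hM : 0 ≤ M} {φ : U → X} {ψ : U → Kerr.region a r₀} {ν : NormalField 𝓘(ℝ, E4) ψ}
  (h : D.IsExactKerrEndAlong K U M a r₀ hM φ ψ ν)
include h

/-- The exceptional set `K` is compact. [folklore] -/
theorem isCompact : IsCompact K := h.1

/-- The chart `φ` covers the complement of `K`. [folklore] -/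
theorem compl_subset_range : Kᶜ ⊆ range φ := h.2.1

/-- The chart `φ` is an open embedding. [folklore] -/
theorem isOpenEmbedding : IsOpenEmbedding φ := h.2.2.1

/-- The chart `φ` is smooth (injectivity of the leaf `ψ` is the next clause, `h.2.2.2.2.1`).
[folklore] -/
theorem contMDiff : ContMDiff 𝓘(ℝ, E3) (𝓡 3) ∞ φ := h.2.2.2.1

/-- The leaf `ψ` is a spacelike immersion for `g_{M,a}`. [folklore] -/
theorem isSpacelikeImmersion : (Kerr.smoothMetric M a r₀).IsSpacelikeImmersion 𝓘(ℝ, E3) ψ :=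
  h.2.2.2.2.2.1

/-- `ν` is the future unit normal of the leaf `ψ`. [folklore] -/
theorem isFutureUnitNormal :
    (Kerr.smoothMetric M a r₀).IsFutureUnitNormal 𝓘(ℝ, E3)
      ((Kerr.timeOrientation M a r₀ hM).ofLE le_top) ψ ν :=
  h.2.2.2.2.2.2.1

/-- Off `K` the metric is the induced Kerr metric: `h(dφ v, dφ w) = g_{M,a}(dψ v, dψ w)`.
[cite: CorvinoSchoen2006, Thm. 4] -/
theorem h_eq (y : U) (v w : E3) (hy : φ y ∉ K) :
    D.h.inner (φ y) (mfderiv 𝓘(ℝ, E3) (𝓡 3) φ y v) (mfderiv 𝓘(ℝ, E3) (𝓡 3) φ y w) =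
      Kerr.bilin M a (ψ y : E4) (mfderiv 𝓘(ℝ, E3) 𝓘(ℝ, E4) ψ y v)
        (mfderiv 𝓘(ℝ, E3) 𝓘(ℝ, E4) ψ y w) :=
  h.2.2.2.2.2.2.2.1 y v w hy

/-- Off `K` the tensor `k` is the future second fundamental form of the leaf:
`k(dφ v, dφ w) = K_ν(ψ)(v, w)`. [cite: CorvinoSchoen2006, Thm. 4] -/
theorem k_eq [(Kerr.smoothMetric M a r₀).HasLeviCivita] (y : U) (v w : E3) (hy : φ y ∉ K) :
    D.k (φ y) (mfderiv 𝓘(ℝ, E3) (𝓡 3) φ y v) (mfderiv 𝓘(ℝ, E3) (𝓡 3) φ y w) =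
      (Kerr.smoothMetric M a r₀).secondFundamentalForm 𝓘(ℝ, E3) ψ ν y v w :=
  h.2.2.2.2.2.2.2.2 y v w hy

/-- The chart range `range φ ⊇ X ∖ K` is open. [folklore] -/
theorem isOpen_range : IsOpen (range φ) := h.isOpenEmbedding.isOpen_range

/-! ### Enlarging the exceptional compact set; modification on a compact set -/

/-- **The exceptional compact set may be enlarged**: exact Kerr end data with exceptional set `K`
are exact Kerr end data with any compact exceptional set `K' ⊇ K` (same chart). [folklore] -/
theorem mono {K' : Set X} (hK' : IsCompact K') (hKK' : K ⊆ K') :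
    D.IsExactKerrEndAlong K' U M a r₀ hM φ ψ ν := by
  obtain ⟨-, hKφ, hemb, hφs, hψ, hsp, hν, hh, hk⟩ := h
  refine ⟨hK', fun x hx ↦ hKφ fun hxK ↦ hx (hKK' hxK), hemb, hφs, hψ, hsp, hν,
    fun y v w hy ↦ hh y v w fun hyK ↦ hy (hKK' hyK), ?_⟩
  intro _ y v w hy
  exact hk y v w fun hyK ↦ hy (hKK' hyK)

/-- **Stability under modification on a compact set** (end data form): if `D'` agrees with `D`
off a compact set `B` (`h` and `k` pointwise) and `(K, U, M, a, r₀, φ, ψ, ν)` are exact Kerr end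
data for `D`, then `(K ∪ B, U, M, a, r₀, φ, ψ, ν)` are exact Kerr end data for `D'`. [folklore] -/
theorem of_eq_off_compact {D' : InitialDataSet (𝓡 3) X} {B : Set X} (hB : IsCompact B)
    (hh : ∀ x, x ∉ B → D'.h.inner x = D.h.inner x) (hk : ∀ x, x ∉ B → D'.k x = D.k x) :
    D'.IsExactKerrEndAlong (K ∪ B) U M a r₀ hM φ ψ ν := by
  obtain ⟨hK, hKφ, hemb, hφs, hψ, hsp, hν, hh', hk'⟩ := h
  refine ⟨hK.union hB, fun x hx ↦ hKφ fun hxK ↦ hx (Or.inl hxK), hemb, hφs, hψ, hsp, hν,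
    fun y v w hy ↦ ?_, ?_⟩
  · rw [mem_union, not_or] at hy
    rw [hh _ hy.2]
    exact hh' y v w hy.1
  · intro _ y v w hy
    rw [mem_union, not_or] at hy
    rw [hk _ hy.2]
    exact hk' y v w hy.1

end IsExactKerrEndAlong

/-- **Stability of Kerr-endedness under modification on a compact set**: if `D'` agrees with `D`
off a compact set `B` (`h_{D'}(x) = h_D(x)` and `k_{D'}(x) = k_D(x)` for `x ∉ B`) and `D` has an
exact Kerr end, then so has `D'` (enlarge the exceptional set `K` to `K ∪ B`). [folklore] -/
theorem HasExactKerrEnd.of_eq_off_compact {D D' : InitialDataSet (𝓡 3) X} (hD : D.HasExactKerrEnd)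
    {B : Set X} (hB : IsCompact B) (hh : ∀ x, x ∉ B → D'.h.inner x = D.h.inner x)
    (hk : ∀ x, x ∉ B → D'.k x = D.k x) : D'.HasExactKerrEnd := by
  intro _
  obtain ⟨K, U, M, a, r₀, hM, φ, ψ, ν, h⟩ := hD.exists
  exact ⟨K ∪ B, U, M, a, r₀, hM, φ, ψ, ν, h.of_eq_off_compact hB hh hk⟩

/-- Kerr-endedness depends only on the values of `h` and `k`: data with the same scalar products
and the same tensors `k` everywhere are simultaneously Kerr-ended (the case `B = ∅`). [folklore] -/
theorem HasExactKerrEnd.congr {D D' : InitialDataSet (𝓡 3) X} (hD : D.HasExactKerrEnd)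
    (hh : ∀ x, D'.h.inner x = D.h.inner x) (hk : ∀ x, D'.k x = D.k x) : D'.HasExactKerrEnd :=
  hD.of_eq_off_compact isCompact_empty (fun x _ ↦ hh x) fun x _ ↦ hk x

/-! ### Invariance under pull-back by diffeomorphisms -/

section Comap

variable {X' : Type*} [TopologicalSpace X'] [ChartedSpace E3 X'] [IsManifold (𝓡 3) ∞ X']

/-- **Exact Kerr end data transport along a diffeomorphism** (end data form). Let
`(K, U, M, a, r₀, φ, ψ, ν)` be exact Kerr end data for `D` on `X`, and let `Θ : X' → X` be smooth
with injective differentials and with a smooth two-sided inverse `Ψ : X → X'`. Then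
`(Ψ '' K, U, M, a, r₀, Ψ ∘ φ, ψ, ν)` are exact Kerr end data for the pulled-back datum
`Θ^* D = D.comap Θ`: `Ψ '' K = Θ⁻¹(K)` is compact, `Ψ ∘ φ` is a smooth open embedding covering
`X' ∖ Ψ '' K`, and `(Ψ ∘ φ)^*(Θ^* h) = (Θ ∘ Ψ ∘ φ)^* h = φ^* h` (chain rule for pull-backs),
likewise for `k`. Bartnik–Isenberg 2004, §2 (diffeomorphism covariance of data); O'Neill 1983,
Ch. 3, p. 58 (functoriality of pull-back). [cite: BartnikIsenberg2004, §2] -/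
theorem IsExactKerrEndAlong.comap_of_inverse [Kerr.Facts] {D : InitialDataSet (𝓡 3) X} {K : Set X}
    {U : Opens E3} {M a r₀ : ℝ} {hM : 0 ≤ M} {φ : U → X} {ψ : U → Kerr.region a r₀}
    {ν : NormalField 𝓘(ℝ, E4) ψ} (h : D.IsExactKerrEndAlong K U M a r₀ hM φ ψ ν)
    (Θ : X' → X) (hΘ : ContMDiff (𝓡 3) (𝓡 3) (∞ + 1) Θ)
    (hΘ' : ∀ u, Injective (mfderiv (𝓡 3) (𝓡 3) Θ u)) (Ψ : X → X')
    (hΨ : ContMDiff (𝓡 3) (𝓡 3) ∞ Ψ) (hΨΘ : ∀ x, Ψ (Θ x) = x) (hΘΨ : ∀ x, Θ (Ψ x) = x) :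
    (D.comap Θ hΘ hΘ').IsExactKerrEndAlong (Ψ '' K) U M a r₀ hM (Ψ ∘ φ) ψ ν := by
  obtain ⟨hK, hKφ, hemb, hφs, hψ, hsp, hν, hh, hk⟩ := h
  have hΘs : ContMDiff (𝓡 3) (𝓡 3) ∞ Θ := hΘ.of_le le_self_add
  -- `Ψ` as a homeomorphism `X ≃ₜ X'` with inverse `Θ`
  let H : X ≃ₜ X' :=
    { toFun := Ψ
      invFun := Θ
      left_inv := hΘΨ
      right_inv := hΨΘ
      continuous_toFun := hΨ.continuous
      continuous_invFun := hΘs.continuous }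
  have hHcoe : ⇑H = Ψ := rfl
  -- the transported chart `Ψ ∘ φ`
  have hφ's : ContMDiff 𝓘(ℝ, E3) (𝓡 3) ∞ (Ψ ∘ φ) := hΨ.comp hφs
  have hemb' : IsOpenEmbedding (Ψ ∘ φ) := by
    rw [← hHcoe]
    exact H.isOpenEmbedding.comp hemb
  have hcomp : Θ ∘ (Ψ ∘ φ) = φ := funext fun y ↦ hΘΨ (φ y)
  have hcov : (Ψ '' K)ᶜ ⊆ range (Ψ ∘ φ) := by
    intro x hx
    have hΘx : Θ x ∉ K := fun hmem ↦ hx ⟨Θ x, hmem, hΨΘ x⟩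
    obtain ⟨y, hy⟩ := hKφ hΘx
    exact ⟨y, by rw [Function.comp_apply, hy, hΨΘ]⟩
  have hoff : ∀ y : U, (Ψ ∘ φ) y ∉ Ψ '' K → φ y ∉ K := fun y hy hmem ↦ hy ⟨φ y, hmem, rfl⟩
  -- the chain rule for the two pull-backs: `(Ψ ∘ φ)^* (Θ^* b) = (Θ ∘ Ψ ∘ φ)^* b = φ^* b`
  have hchain : ∀ b : Π x : X, TangentSpace (𝓡 3) x →L[ℝ] TangentSpace (𝓡 3) x →L[ℝ] ℝ,
      pullbackBilin (I := 𝓡 3) (I' := 𝓘(ℝ, E3)) (Ψ ∘ φ)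
          (pullbackBilin (I := 𝓡 3) (I' := 𝓡 3) Θ b) =
        pullbackBilin (I := 𝓡 3) (I' := 𝓘(ℝ, E3)) φ b := by
    intro b
    rw [← pullbackBilin_comp (hΘs.mdifferentiable (by simp)) (hφ's.mdifferentiable (by simp)) b,
      hcomp]
  refine ⟨hK.image hΨ.continuous, hcov, hemb', hφ's, hψ, hsp, hν, fun y v w hy ↦ ?_, ?_⟩
  · -- metric clause: `(Θ^* D).h = Θ^* h`
    change pullbackBilin (I := 𝓡 3) (I' := 𝓘(ℝ, E3)) (Ψ ∘ φ)
        (pullbackBilin (I := 𝓡 3) (I' := 𝓡 3) Θ D.h.inner) y v w = _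
    rw [hchain D.h.inner, pullbackBilin_apply]
    exact hh y v w (hoff y hy)
  · -- second fundamental form clause: `(Θ^* D).k = Θ^* k`
    intro _ y v w hy
    change pullbackBilin (I := 𝓡 3) (I' := 𝓘(ℝ, E3)) (Ψ ∘ φ)
        (pullbackBilin (I := 𝓡 3) (I' := 𝓡 3) Θ D.k) y v w = _
    rw [hchain D.k, pullbackBilin_apply]
    exact hk y v w (hoff y hy)

/-- **Kerr-endedness is invariant under pull-back by a diffeomorphism**: if `D` on `X` has an exact
Kerr end and `Θ : X' → X` is smooth with injective differentials and a smooth two-sided inverse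
`Ψ`, then `Θ^* D = D.comap Θ` has an exact Kerr end (chart `Ψ ∘ φ`, exceptional set `Ψ '' K`,
same Kerr leaf). Bartnik–Isenberg 2004, §2; O'Neill 1983, Ch. 3, p. 58.
[cite: BartnikIsenberg2004, §2] -/
theorem HasExactKerrEnd.comap_of_inverse {D : InitialDataSet (𝓡 3) X} (hD : D.HasExactKerrEnd)
    (Θ : X' → X) (hΘ : ContMDiff (𝓡 3) (𝓡 3) (∞ + 1) Θ)
    (hΘ' : ∀ u, Injective (mfderiv (𝓡 3) (𝓡 3) Θ u)) (Ψ : X → X')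
    (hΨ : ContMDiff (𝓡 3) (𝓡 3) ∞ Ψ) (hΨΘ : ∀ x, Ψ (Θ x) = x) (hΘΨ : ∀ x, Θ (Ψ x) = x) :
    (D.comap Θ hΘ hΘ').HasExactKerrEnd := by
  intro _
  obtain ⟨K, U, M, a, r₀, hM, φ, ψ, ν, h⟩ := hD.exists
  exact ⟨Ψ '' K, U, M, a, r₀, hM, Ψ ∘ φ, ψ, ν, h.comap_of_inverse Θ hΘ hΘ' Ψ hΨ hΨΘ hΘΨ⟩

/-- **Kerr-endedness is invariant under pull-back by a diffeomorphism** (Mathlib `Diffeomorph`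
form): for a `C^∞` diffeomorphism `Φ : X' ≃ X` (with the pull-back hypotheses `hΦ`, `hΦ'` of
`InitialDataSet.comap` supplied by the caller) and a Kerr-ended `D` on `X`, the datum
`Φ^* D = D.comap Φ` on `X'` is Kerr-ended. Bartnik–Isenberg 2004, §2.
[cite: BartnikIsenberg2004, §2] -/
theorem HasExactKerrEnd.comap_diffeomorph {D : InitialDataSet (𝓡 3) X} (hD : D.HasExactKerrEnd)
    (Φ : Diffeomorph (𝓡 3) (𝓡 3) X' X ∞) (hΦ : ContMDiff (𝓡 3) (𝓡 3) (∞ + 1) Φ)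
    (hΦ' : ∀ u, Injective (mfderiv (𝓡 3) (𝓡 3) Φ u)) :
    (D.comap Φ hΦ hΦ').HasExactKerrEnd :=
  hD.comap_of_inverse Φ hΦ hΦ' Φ.symm Φ.symm.contMDiff Φ.symm_apply_apply Φ.apply_symm_apply

end Comap

end InitialDataSet

/-! ### The breathing family of a Kerr-ended datum -/

namespace InitialDataSet

-- `AFEnd.breatheFamily` (`AFEndBreathingData.lean`) is stated for `X : Type`
variable {X : Type} [TopologicalSpace X] [ChartedSpace E3 X] [IsManifold (𝓡 3) ∞ X] [T2Space X]

/-- **The breathing family of a Kerr-ended datum consists of Kerr-ended data**: for breathing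
data `B` on an end `e` of `X` (`AFEndBreathingData.lean`) and every `t`, the member
`(breathe (σ t))^* D` agrees with `D` off the compact core `breatheCore e z₀ r`
(`AFEnd.breatheFamily_eq_of_not_mem_core`), hence is Kerr-ended when `D` is
(`HasExactKerrEnd.of_eq_off_compact`). [folklore] -/
theorem HasExactKerrEnd.breatheFamily {e : AFEnd X} {z₀ : E3} {r : ℝ}
    (B : AFEnd.BreathingData e z₀ r) {D : InitialDataSet (𝓡 3) X} (hD : D.HasExactKerrEnd)
    (t : ℝ) : (AFEnd.breatheFamily B D t).HasExactKerrEnd :=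
  hD.of_eq_off_compact (AFEnd.isCompact_breatheCore B)
    (fun _ hx ↦ (AFEnd.breatheFamily_eq_of_not_mem_core B D t hx).1)
    fun _ hx ↦ (AFEnd.breatheFamily_eq_of_not_mem_core B D t hx).2

end InitialDataSet

/-! ### Non-vacuity: the Kerr–Schild slice data are Kerr-ended -/

namespace Kerr

/-- **The Kerr–Schild slice data are exact Kerr end data with empty exceptional set**: for
`Kerr.data M a r₀ hM` on `X = Kerr.slice a r₀` take `K = ∅`, `U = Kerr.slice a r₀`, `φ = id`,
`ψ = sliceEmbed a r₀` (`y ↦ (0, y)`), `ν = sliceNormal M a r₀`; the metric clause is the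
definition of the induced metric and the `k` clause is `Kerr.sliceK_apply` (given the named fact
`Kerr.isFutureUnitNormal_sliceNormal` for the normal). Dafermos–Rodnianski arXiv:0811.0354, §5.1;
Cook 2000, §3.2.2. [cite: arXiv08110354, §5.1] -/
theorem isExactKerrEndAlong_data [Facts] [SliceFacts] (M a r₀ : ℝ) (hM : 0 ≤ M)
    (hν : isFutureUnitNormal_sliceNormal M a r₀) :
    (data M a r₀ hM).IsExactKerrEndAlong ∅ (slice a r₀) M a r₀ hM id (sliceEmbed a r₀)
      (sliceNormal M a r₀) := by
  refine ⟨isCompact_empty, fun x _ ↦ ⟨x, rfl⟩, IsOpenEmbedding.id, contMDiff_id,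
    sliceEmbed_injective a r₀, SliceFacts.isSpacelikeImmersion_sliceEmbed M a r₀ hM, hν hM,
    fun y v w _ ↦ ?_, ?_⟩
  · rw [mfderiv_id]
    rfl
  · intro _ y v w _
    rw [mfderiv_id]
    exact sliceK_apply M a r₀ y v w

/-- **The Kerr–Schild slice data `Kerr.data M a r₀ hM` have an exact Kerr end** (with empty
exceptional set; non-vacuity of `InitialDataSet.HasExactKerrEnd`), given the named fact
`Kerr.isFutureUnitNormal_sliceNormal`. Dafermos–Rodnianski arXiv:0811.0354, §5.1.
[cite: arXiv08110354, §5.1] -/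
theorem hasExactKerrEnd_data [Facts] [SliceFacts] (M a r₀ : ℝ) (hM : 0 ≤ M)
    (hν : isFutureUnitNormal_sliceNormal M a r₀) : (data M a r₀ hM).HasExactKerrEnd := by
  intro _
  exact ⟨∅, slice a r₀, M, a, r₀, hM, id, sliceEmbed a r₀, sliceNormal M a r₀,
    isExactKerrEndAlong_data M a r₀ hM hν⟩

end Kerr

end Literature.Geometry.Lorentzian

end
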